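import Literature.Geometry.Riemannian.ConformalHessian
import Literature.Geometry.Riemannian.SphericalCapNormal
import Literature.Geometry.Riemannian.MetricTraceScaling
import Literature.Geometry.Lorentzian.HypersurfaceRestriction
import Literature.Geometry.Lorentzian.SecondFundamentalFormApply
import Literature.Geometry.Lorentzian.PseudoRiemannianMetricProofs
import Literature.Geometry.Lorentzian.EinsteinProofs
import HarnessLib

/-!
# Hypersurfaces under a conformal change of the ambient metric: `K̂ = r K + dr(ν) f^*g`, `Ĥ = H/r + m dr(ν)/r²`
(topic `Geometry/Lorentzian`, hypersurface theory of `Hypersurface.lean`)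

For two `C^n` pseudo-Riemannian metrics `g`, `ĝ` on `TM` with `ĝ = r² g` (`r : M → ℝ`
differentiable and non-vanishing where needed; `ConformalHessian.lean` proves the transformation
of the Levi-Civita connection, `GGSU.leviCivita_conformal_apply`: `∇̂_X Y = ∇_X Y + (dr(X)/r) Y +
(dr(Y)/r) X - (g(X,Y)/r) grad_g r`), and a map `f : N → M` with a normal field which is the
restriction `Y ∘ f` of an ambient vector field `Y` (the case of level sets `ν = ∇F/‖∇F‖` and,
locally, of every embedded hypersurface), this file PROVES the classical transformation laws of
the extrinsic geometry in the vocabulary of `Hypersurface.lean` (`normalDerivAlong`,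
`secondFundamentalForm` with `K_ν(v, w) = g(D_v ν, df w)`, `meanCurvature = tr_{f^*g} K`):

* `normalDerivAlong_comp_conformal` — `D̂_v (Y ∘ f) = D_v (Y ∘ f) + (dr(df v)/r) Y +
  (dr(Y)/r) df v - (g(df v, Y)/r) ♯dr` (from `D_v (Y ∘ f) = ∇_{df v} Y`,
  `normalDerivAlong_comp_eq_leviCivita` of `SphericalCapNormal.lean`);
* `normalDerivAlong_comp_smul` — the Leibniz rule `D_v ((φY) ∘ f) = φ D_v (Y ∘ f) + dφ(df v) Y`;
* `secondFundamentalForm_comp_conformal` — for `Y ∘ f` `g`-normal at `y` and the rescaled normal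
  `ν̂ = r⁻¹ (Y ∘ f)`: **`K̂(v, w) = r K(v, w) + dr(Y) g(df v, df w)`**;
* `isUnitNormal_conformal`, `IsSpacelikeImmersion.conformal` — `r⁻¹ ν` is a `ĝ`-unit normal,
  `f` stays spacelike;
* `meanCurvature_comp_conformal` — **`Ĥ = H/r + m · dr(Y)/r²`**, `m = dim N` (for `r = e^φ`:
  `Ĥ = e^{-φ}(H + m ∂_ν φ)`), the trace being taken with respect to `f^*ĝ = r² f^*g`
  (`trace_constSmul`, `MetricTraceScaling.lean`).

Standard material: Besse, *Einstein manifolds* (1987), Thm. 1.159 (conformal changes); the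
hypersurface formulas e.g. in J. F. Escobar, Ann. of Math. 136 (1992), §1 (`ĝ = u^{4/(n-2)} g`:
`ĥ = … `). Written for the big-sphere argument turning a mean-convex compact domain of `ℝⁿ⁺¹`
into a domain of positive scalar curvature with mean-convex boundary
(`Literature.Geometry.Riemannian.Sweeney2026_pscMeanConvex`, Lawson–Michelsohn 1984). Everything is
proved; no definitions, no named facts.

## References

* B. O'Neill, *Semi-Riemannian geometry* (1983), Ch. 3, Thm. 3.11 (Koszul formula), Prop. 3.18;
  Ch. 4, Lemma 4.4 ff. [ONeill1983]
* A. L. Besse, *Einstein manifolds*, Springer 1987, Thm. 1.159. [Besse1987]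
-/

noncomputable section

open Bundle Set Function Filter
open scoped Manifold ContDiff Topology

namespace Literature.Geometry.Lorentzian

namespace PseudoRiemannianMetric

variable {E : Type*} [NormedAddCommGroup E] [NormedSpace ℝ E] {H : Type*} [TopologicalSpace H]
  {I : ModelWithCorners ℝ E H} {M : Type*} [TopologicalSpace M] [ChartedSpace H M]
  [IsManifold I ∞ M]
  {E' : Type*} [NormedAddCommGroup E'] [NormedSpace ℝ E'] {H' : Type*} [TopologicalSpace H']
  {I' : ModelWithCorners ℝ E' H'} {N : Type*} [TopologicalSpace N] [ChartedSpace H' N]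
  [IsManifold I' ∞ N] {n : ℕ∞ω} [Fact (1 ≤ n)] [CompleteSpace E] [FiniteDimensional ℝ E]
  {g ĝ : PseudoRiemannianMetric I n E (TangentSpace I : M → Type _)} [g.HasLeviCivita]
  [ĝ.HasLeviCivita] {r : M → ℝ}

/-- **Covariant derivative of a restricted ambient field along a map, under a conformal change.**
If `ĝ = r² g`, `f : N → M` is differentiable at the interior point `y`, the ambient vector field
`Y` is differentiable at `f y` and `r (f y) ≠ 0`, then for `v ∈ T_y N`
`D̂_v (Y ∘ f) = D_v (Y ∘ f) + (dr(df v)/r) Y + (dr(Y)/r) df v - (g(df v, Y)/r) ♯_g dr`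
(`D_v (Y ∘ f) = ∇_{df v} Y`, `normalDerivAlong_comp_eq_leviCivita`, and the conformal change of the
Levi-Civita connection, `GGSU.leviCivita_conformal_apply`; Besse 1987, Thm. 1.159 (a)).
[cite: ONeill1983, Ch. 3, Thm. 3.11 (Koszul formula)] -/
theorem normalDerivAlong_comp_conformal (hval : ∀ x, ĝ.val x = (r x) ^ 2 • g.val x)
    {f : N → M} {Y : Π x : M, TangentSpace I x} {y : N} (hy : I'.IsInteriorPoint y)
    (hf : MDifferentiableAt I' I f y) (hY : MDiffAt (T% Y) (f y)) (hr : MDiffAt r (f y))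
    (hr0 : r (f y) ≠ 0) (v : TangentSpace I' y) :
    ĝ.normalDerivAlong f (fun z ↦ Y (f z)) y v =
      g.normalDerivAlong f (fun z ↦ Y (f z)) y v +
        (mvfderiv I r (f y) (mfderiv I' I f y v) / r (f y)) • Y (f y) +
        (mvfderiv I r (f y) (Y (f y)) / r (f y)) • mfderiv I' I f y v -
        (g.val (f y) (mfderiv I' I f y v) (Y (f y)) / r (f y)) •
          g.sharp (f y) (mvfderiv I r (f y)).toLinearMap := by
  rw [Literature.Geometry.Riemannian.normalDerivAlong_comp_eq_leviCivita ĝ hy hf hY,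
    Literature.Geometry.Riemannian.normalDerivAlong_comp_eq_leviCivita g hy hf hY,
    Literature.Geometry.Riemannian.GGSU.leviCivita_conformal_apply hval hr hr0 hY]

omit [Fact (1 ≤ n)] [CompleteSpace E] [ĝ.HasLeviCivita] in
/-- **Leibniz rule for restricted ambient fields along a map**: `D_v ((φ Y) ∘ f) =
φ D_v (Y ∘ f) + dφ(df v) Y` at an interior point (from the Leibniz rule of the Levi-Civita
connection, `D_v (Y ∘ f) = ∇_{df v} Y`). [cite: ONeill1983, Ch. 3, Prop. 3.18] -/
theorem normalDerivAlong_comp_smul {f : N → M} {Y : Π x : M, TangentSpace I x} {φ : M → ℝ}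
    {y : N} (hy : I'.IsInteriorPoint y) (hf : MDifferentiableAt I' I f y)
    (hY : MDiffAt (T% Y) (f y)) (hφ : MDiffAt φ (f y)) (v : TangentSpace I' y) :
    g.normalDerivAlong f (fun z ↦ φ (f z) • Y (f z)) y v =
      φ (f y) • g.normalDerivAlong f (fun z ↦ Y (f z)) y v +
        mvfderiv I φ (f y) (mfderiv I' I f y v) • Y (f y) := by
  have hφY : MDiffAt (T% (φ • Y)) (f y) := hφ.smul_section hY
  have h1 := Literature.Geometry.Riemannian.normalDerivAlong_comp_eq_leviCivita g (Y := φ • Y) hy hf hφY v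
  have h2 := g.leviCivita.isCovariantDerivativeOn.leibniz hY hφ
  change g.normalDerivAlong f (fun z ↦ (φ • Y) (f z)) y v = _
  rw [h1, h2]
  rw [Literature.Geometry.Riemannian.normalDerivAlong_comp_eq_leviCivita g hy hf hY]
  simp only [add_apply, smul_apply, ContinuousLinearMap.smulRight_apply]

/-- **Second fundamental form under a conformal change of the ambient metric.** Let `ĝ = r² g`,
`f : N → M`, `Y` an ambient vector field whose restriction `Y ∘ f` is `g`-normal to `f` at the
interior point `y`, everything differentiable at `y` / `f y`, `r (f y) ≠ 0`. Then the second
fundamental form of `f` for `ĝ` and the rescaled normal `ν̂ = r⁻¹ (Y ∘ f)` is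
`K̂(v, w) = r K(v, w) + dr(Y) g(df v, df w)` (with the tree's convention `K_ν(v,w) = g(D_v ν, df w)`).
Classical (Besse 1987, Thm. 1.159; e.g. Escobar 1992, (1.2): `ĥ = r h + (∂r/∂ν) g` for
`ĝ = r² g`). [cite: ONeill1983, Ch. 3, Thm. 3.11 (Koszul formula)] -/
theorem secondFundamentalForm_comp_conformal [FiniteDimensional ℝ E']
    (hval : ∀ x, ĝ.val x = (r x) ^ 2 • g.val x)
    {f : N → M} {Y : Π x : M, TangentSpace I x} {y : N} (hy : I'.IsInteriorPoint y)
    (hf : MDifferentiableAt I' I f y) (hY : MDiffAt (T% Y) (f y)) (hr : MDiffAt r (f y))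
    (hr0 : r (f y) ≠ 0)
    (hnormal : ∀ w : TangentSpace I' y, g.val (f y) (Y (f y)) (mfderiv I' I f y w) = 0)
    (v w : TangentSpace I' y) :
    ĝ.secondFundamentalForm I' f (fun z ↦ (r (f z))⁻¹ • Y (f z)) y v w =
      r (f y) * g.secondFundamentalForm I' f (fun z ↦ Y (f z)) y v w +
        mvfderiv I r (f y) (Y (f y)) * g.val (f y) (mfderiv I' I f y v) (mfderiv I' I f y w) := by
  have hφ : MDiffAt r⁻¹ (f y) := hr.inv hr0
  have hνY : MDiffAt (T% (r⁻¹ • Y)) (f y) := hφ.smul_section hY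
  have hν' : MDifferentiableAt I' I.tangent
      (fun z ↦ (TotalSpace.mk' E (f z) ((r (f z))⁻¹ • Y (f z)) : TangentBundle I M)) y :=
    hνY.comp y hf
  have hνg : MDifferentiableAt I' I.tangent
      (fun z ↦ (TotalSpace.mk' E (f z) (Y (f z)) : TangentBundle I M)) y := hY.comp y hf
  rw [secondFundamentalForm_apply_holds hy hν' v w, secondFundamentalForm_apply_holds hy hνg v w]
  change ĝ.val (f y) (ĝ.normalDerivAlong f (fun z ↦ r⁻¹ (f z) • Y (f z)) y v) _ = _
  rw [normalDerivAlong_comp_smul (g := ĝ) hy hf hY hφ v,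
    normalDerivAlong_comp_conformal hval hy hf hY hr hr0 v, hval (f y)]
  simp only [map_add, map_sub, map_smul, add_apply, sub_apply, smul_apply,
    smul_eq_mul, Pi.inv_apply, hnormal w, val_sharp_apply, ContinuousLinearMap.coe_coe]
  rw [g.symm (f y) (mfderiv I' I f y v) (Y (f y)), hnormal v]
  field_simp
  ring

omit [IsManifold I' ∞ N] [Fact (1 ≤ n)] [CompleteSpace E] [FiniteDimensional ℝ E] [g.HasLeviCivita]
  [ĝ.HasLeviCivita] in
/-- A `g`-unit normal field `ν` of sign `+1` along `f` rescales to the `ĝ`-unit normal `r⁻¹ ν` for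
`ĝ = r² g`, `r > 0` along `f`. [folklore] -/
theorem isUnitNormal_conformal (hval : ∀ x, ĝ.val x = (r x) ^ 2 • g.val x) {f : N → M}
    {ν : NormalField I f} (hν : g.IsUnitNormal I' f ν 1) (hr : ∀ z, 0 < r (f z)) :
    ĝ.IsUnitNormal I' f (fun z ↦ (r (f z))⁻¹ • ν z) 1 := by
  refine ⟨fun z w ↦ ?_, fun z ↦ ?_⟩
  · rw [hval (f z)]
    simp only [map_smul, smul_apply, smul_eq_mul, hν.1 z w, mul_zero]
  · rw [hval (f z)]
    simp only [map_smul, smul_apply, smul_eq_mul, hν.2 z]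
    field_simp [(hr z).ne']

omit [IsManifold I' ∞ N] [Fact (1 ≤ n)] [CompleteSpace E] [FiniteDimensional ℝ E] [g.HasLeviCivita]
  [ĝ.HasLeviCivita] in
/-- A `g`-spacelike immersion is `ĝ`-spacelike for `ĝ = r² g`, `r ≠ 0` along `f`. [folklore] -/
theorem IsSpacelikeImmersion.conformal (hval : ∀ x, ĝ.val x = (r x) ^ 2 • g.val x) {f : N → M}
    (hf : g.IsSpacelikeImmersion I' f) (hr : ∀ z, r (f z) ≠ 0) : ĝ.IsSpacelikeImmersion I' f := by
  refine ⟨hf.1, fun z v hv ↦ ?_⟩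
  rw [inducedBilin_apply, hval (f z)]
  simp only [smul_apply, smul_eq_mul]
  exact mul_pos (pow_pos (lt_of_le_of_ne (sq_nonneg _) (pow_ne_zero 2 (hr z)).symm) 1 |>.trans_eq
    (pow_one _)) (by simpa using hf.2 z v hv)


/-- **Mean curvature under a conformal change of the ambient metric**: in the situation of
`secondFundamentalForm_comp_conformal` (ambient field `Y` with `Y ∘ f` `g`-normal at `y`,
`ĝ = r² g`, `r ≠ 0` along `f`), the mean curvature of `f` for `ĝ` and the rescaled normal
`r⁻¹ (Y ∘ f)` is `Ĥ = H / r + m · dr(Y) / r²`, `m = dim N` (trace of `K̂ = r K + dr(Y) f^*g`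
with respect to `f^*ĝ = r² f^*g`). For `r = e^φ` this is the classical
`Ĥ = e^{-φ} (H + m ∂_ν φ)`. [cite: ONeill1983, Ch. 3, Thm. 3.11 (Koszul formula)] -/
theorem meanCurvature_comp_conformal [FiniteDimensional ℝ E']
    (hval : ∀ x, ĝ.val x = (r x) ^ 2 • g.val x) {f : N → M} {Y : Π x : M, TangentSpace I x}
    (hpb : contMDiff_pullbackBilin I M I' N n) (hf : g.IsSpacelikeImmersion I' f)
    (hr' : ∀ z, r (f z) ≠ 0) {y : N} (hy : I'.IsInteriorPoint y) (hY : MDiffAt (T% Y) (f y))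
    (hr : MDiffAt r (f y))
    (hnormal : ∀ w : TangentSpace I' y, g.val (f y) (Y (f y)) (mfderiv I' I f y w) = 0) :
    ĝ.meanCurvature f hpb (hf.conformal hval hr') (fun z ↦ (r (f z))⁻¹ • Y (f z)) y =
      (r (f y))⁻¹ * g.meanCurvature f hpb hf (fun z ↦ Y (f z)) y +
        Module.finrank ℝ E' * mvfderiv I r (f y) (Y (f y)) / r (f y) ^ 2 := by
  have hfd : MDifferentiableAt I' I f y := (hf.contMDiff y).mdifferentiableAt (by simp)
  have hK : ĝ.secondFundamentalForm I' f (fun z ↦ (r (f z))⁻¹ • Y (f z)) y =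
      r (f y) • g.secondFundamentalForm I' f (fun z ↦ Y (f z)) y +
        mvfderiv I r (f y) (Y (f y)) • (g.inducedMetric f hpb hf).toBilinForm y := by
    refine LinearMap.ext fun v ↦ LinearMap.ext fun w ↦ ?_
    rw [secondFundamentalForm_comp_conformal hval hy hfd hY hr (hr' y) hnormal v w]
    simp only [LinearMap.add_apply, LinearMap.smul_apply, smul_eq_mul, toBilinForm_apply,
      inducedMetric_val, inducedBilin_apply]
  have hval' : ((ĝ.inducedMetric f hpb (hf.conformal hval hr')).val y : E' →L[ℝ] E' →L[ℝ] ℝ) =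
      ((g.inducedMetric f hpb hf).constSmul ((r (f y)) ^ 2) (pow_ne_zero 2 (hr' y))).val y := by
    ext v w
    simp only [inducedMetric_val, inducedBilin_apply, constSmul_apply, hval (f y), smul_apply,
      smul_eq_mul]
  rw [meanCurvature, hK, trace_congr_of_val_eq hval', trace_constSmul, trace_add, trace_smul,
    trace_smul, trace_toBilinForm_eq, meanCurvature]
  field_simp


end PseudoRiemannianMetric

end Literature.Geometry.Lorentzian

end
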